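import Summits.AtomisticToContinuum.Crystallization.Theorems.FrustratedLawDichotomyStrainedPatchHomValueT2TrackFast
import Summits.AtomisticToContinuum.Crystallization.Theorems.FrustratedLawDichotomyStrainedPatchHomValueT2SoundG
import Summits.AtomisticToContinuum.Crystallization.Theorems.FrustratedLawDichotomyStrainedPatchHomEntryFitCentred
import Summits.AtomisticToContinuum.Crystallization.Theorems.FrustratedLawDichotomyStrainedPatchFrameCellsB

/-!
# (I1) prefilter part A — exact pieces behind `preLabels` (`…HomValueT2TrackFast` §16; critic row 1674 (B) (I1) docket item 5 `preLabels_complete`,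
# first instalment; 27623 `(H) HomFloor`; decomp-a2c hand-1 g49)

`normSq_latPt_one`: `3·‖p_b‖² = hexNormSq3 b` (`p_b = Σ b_i f_i` in the hexagonal frame);  `norm_apply_ge`: `‖U q‖ ≥ (1 − ‖U − 1‖)·‖q‖`;
`norm_arg_ge`: `‖p_b + s + ξ‖ ≥ ‖p_b‖ − 1 − ‖ξ‖` (`‖s‖ = 1`).  No definitions; 0 sorry; standard axioms.  `--supports stmt-AtomisticToContinuum-27623`.
-/

noncomputable section

namespace Summit.AtomisticToContinuum.Crystallization.Theorems.FrustratedLawDichotomyStrainedPatchHomValueT2Kit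

open scoped BigOperators RealInnerProductSpace
open Finset
open Literature.Analysis.ValidatedNumerics.Numerics
open Summit.AtomisticToContinuum.Crystallization.Theorems.ChargedEnergyGapNegative (E3)
open Summit.AtomisticToContinuum.Crystallization.Theorems.FrustratedLawDichotomyStrainedPatchHomSplit (latPt hexFrame hcpShift)
open Summit.AtomisticToContinuum.Crystallization.Theorems.FrustratedLawDichotomyStrainedPatchHomEntryGramHcp (hexFrame_apply₀ hexFrame_apply₁ hexFrame_apply₂)
open Summit.AtomisticToContinuum.Crystallization.Theorems.FrustratedLawDichotomyStrainedPatchHomForceKit (latPt_apply)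
open Summit.AtomisticToContinuum.Crystallization.Theorems.FrustratedLawDichotomyStrainedPatchHomCurvLeaf (boxLabels7)
open Summit.AtomisticToContinuum.Crystallization.Theorems.FrustratedLawDichotomyStrainedPatchFrameCells (norm_hcpShift)
open Summit.AtomisticToContinuum.Crystallization.Theorems.FrustratedLawDichotomyStrainedPatchHomEntryFitCentred (norm_sub_le_sqrt_of_entries)

/-- ★ `3·‖p_b‖² = 3b₀² + 3b₁² + 3b₀b₁ + 8b₂²` exactly. [arithmetic: `|f₀| = |f₁| = 1`, `f₀·f₁ = 1/2`, `|f₂|² = 8/3`] -/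
theorem normSq_latPt_one (b : Fin 3 → ℤ) : ‖latPt (1 : E3 →L[ℝ] E3) hexFrame b‖ ^ 2 * 3 = ((hexNormSq3 b : ℤ) : ℝ) := by
  have h3 : Real.sqrt 3 ^ 2 = 3 := Real.sq_sqrt (by norm_num)
  have h83 : Real.sqrt (8 / 3) ^ 2 = 8 / 3 := Real.sq_sqrt (by norm_num)
  have hx : ∀ a : Fin 3, (latPt (1 : E3 →L[ℝ] E3) hexFrame b) a = ∑ i : Fin 3, hexFrame i a * ((b i : ℤ) : ℝ) := fun a => by
    rw [latPt_apply]; rfl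
  rw [EuclideanSpace.norm_eq, Real.sq_sqrt (Finset.sum_nonneg fun i _ => sq_nonneg _)]
  simp only [Fin.sum_univ_three, Real.norm_eq_abs, sq_abs, hx, hexFrame_apply₀, hexFrame_apply₁, hexFrame_apply₂]
  unfold hexNormSq3
  push_cast
  nlinarith [h3, h83]

/-- `‖U q‖ ≥ (1 − ‖U − 1‖)·‖q‖`. [folklore] -/
theorem norm_apply_ge (U : E3 →L[ℝ] E3) (q : E3) : (1 - ‖U - 1‖) * ‖q‖ ≤ ‖U q‖ := by
  have h1 : ‖(U - 1) q‖ ≤ ‖U - 1‖ * ‖q‖ := (U - 1).le_opNorm q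
  have h2 : ‖q‖ - ‖(U - 1) q‖ ≤ ‖U q‖ := by
    have e : U q = q + (U - 1) q := by simp
    rw [e]
    have := norm_sub_norm_le q (-((U - 1) q))
    rw [norm_neg, sub_neg_eq_add] at this
    linarith [norm_add_le q ((U - 1) q), abs_norm_sub_norm_le q (q + (U - 1) q), norm_le_norm_add_norm_sub' q ((U - 1) q)]
  nlinarith [h1, h2, norm_nonneg q]

/-- `‖p_b + (s + ξ)‖ ≥ ‖p_b‖ − 1 − ‖ξ‖` (`‖s‖ = 1`). [folklore] -/
theorem norm_arg_ge (b : Fin 3 → ℤ) (ξ : E3) :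
    ‖latPt (1 : E3 →L[ℝ] E3) hexFrame b‖ - 1 - ‖ξ‖ ≤ ‖latPt (1 : E3 →L[ℝ] E3) hexFrame b + (hcpShift + ξ)‖ := by
  have h1 := norm_sub_norm_le (latPt (1 : E3 →L[ℝ] E3) hexFrame b) (-(hcpShift + ξ))
  rw [norm_neg, sub_neg_eq_add] at h1
  have h2 : ‖hcpShift + ξ‖ ≤ 1 + ‖ξ‖ := by rw [← norm_hcpShift]; exact norm_add_le _ _
  linarith [le_abs_self (‖latPt (1 : E3 →L[ℝ] E3) hexFrame b‖ - ‖hcpShift + ξ‖)]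

/-- ★ `|ξ|_max`: `‖ξ‖·SC ≤ xiMaxI c w` on the shuffle box. [arithmetic: `…FixedPointInterval.le_natSqrtUp_sq`] -/
theorem norm_xi_le_xiMaxI {c w : (Fin 3 × Fin 3) ⊕ Fin 3 → ℤ} (ξ : E3)
    (hξ : ∀ i : Fin 3, |ξ i - (c (Sum.inr i) : ℝ) / SC| ≤ (w (Sum.inr i) : ℝ) / SC) : ‖ξ‖ * SC ≤ (xiMaxI c w : ℝ) := by
  have hS := SC_pos
  -- per coordinate
  have hco : ∀ i : Fin 3, (ξ i * SC) ^ 2 ≤ (((|c (Sum.inr i)| + w (Sum.inr i)).natAbs : ℕ) : ℝ) ^ 2 := by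
    intro i
    have h := hξ i
    have h1 : |ξ i| ≤ (|(c (Sum.inr i) : ℝ)| + w (Sum.inr i)) / SC := by
      have t := abs_sub_abs_le_abs_sub (ξ i) ((c (Sum.inr i) : ℝ) / SC)
      rw [abs_div, abs_of_pos hS, add_div] at *
      linarith
    have h2 : |ξ i| * SC ≤ |(c (Sum.inr i) : ℝ)| + w (Sum.inr i) := (le_div_iff₀ hS).1 h1
    have h0 : (0 : ℝ) ≤ |(c (Sum.inr i) : ℝ)| + w (Sum.inr i) := le_trans (by positivity) h2
    have e : (((|c (Sum.inr i)| + w (Sum.inr i)).natAbs : ℕ) : ℝ) = |(c (Sum.inr i) : ℝ)| + w (Sum.inr i) := by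
      rw [Nat.cast_natAbs]; push_cast; exact abs_of_nonneg h0
    rw [e, ← sq_abs (ξ i * SC), abs_mul, abs_of_pos hS]
    exact pow_le_pow_left₀ (by positivity) h2 2
  -- the fold
  set t : ℕ := (List.range 3).foldl (fun s n =>
    let i : Fin 3 := ⟨n % 3, by omega⟩
    s + ((|c (Sum.inr i)| + w (Sum.inr i)).natAbs) ^ 2) 0 with ht
  have et : t = 0 + ((|c (Sum.inr 0)| + w (Sum.inr 0)).natAbs) ^ 2 + ((|c (Sum.inr 1)| + w (Sum.inr 1)).natAbs) ^ 2 +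
      ((|c (Sum.inr 2)| + w (Sum.inr 2)).natAbs) ^ 2 := by
    rw [ht]; rfl
  have hsum : (‖ξ‖ * SC) ^ 2 ≤ (t : ℝ) := by
    rw [mul_pow, EuclideanSpace.norm_eq, Real.sq_sqrt (Finset.sum_nonneg fun i _ => sq_nonneg _), et]
    push_cast
    simp only [Fin.sum_univ_three, Real.norm_eq_abs, sq_abs]
    have h0 := hco 0; have h1 := hco 1; have h2 := hco 2
    rw [mul_pow] at h0 h1 h2
    nlinarith [h0, h1, h2]
  have hsq : (t : ℝ) ≤ ((natSqrtUp t : ℕ) : ℝ) ^ 2 := by exact_mod_cast le_natSqrtUp_sq t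
  have hx : xiMaxI c w = (natSqrtUp t : ℤ) := by unfold xiMaxI; rw [ht]
  rw [hx]; push_cast
  exact abs_le_of_sq_le_sq' (hsum.trans hsq) (by positivity) |>.2

/-- `((x.natAbs)² : ℕ)` read in `ℝ` is `x²`. [arithmetic] -/
theorem cast_natAbs_sq (x : ℤ) : (((x.natAbs ^ 2 : ℕ)) : ℝ) = ((x : ℤ) : ℝ) ^ 2 := by
  have h : ((x.natAbs : ℕ) : ℤ) = |x| := Int.natCast_natAbs x
  have h2 : ((x.natAbs : ℕ) : ℝ) = ((|x| : ℤ) : ℝ) := by rw [← h]; simp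
  push_cast
  rw [h2]; push_cast; exact sq_abs _

/-- ★ `‖U − 1‖_F`: `‖U − 1‖·SC ≤ froDevI c w` on the entry box. [folklore chaining: `…HomEntryFitCentred.norm_sub_le_sqrt_of_entries`, `le_natSqrtUp_sq`] -/
theorem norm_sub_one_le_froDevI {c w : (Fin 3 × Fin 3) ⊕ Fin 3 → ℤ} (U : E3 →L[ℝ] E3)
    (hbox : ∀ ab : Fin 3 × Fin 3, |(U (EuclideanSpace.single ab.2 (1 : ℝ))) ab.1 - (c (Sum.inl ab) : ℝ) / SC| ≤ (w (Sum.inl ab) : ℝ) / SC) :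
    ‖U - 1‖ * SC ≤ (froDevI c w : ℝ) := by
  have hS := SC_pos
  -- entrywise deviations from the identity
  have hδ : ∀ a b : Fin 3, ((1 : E3 →L[ℝ] E3) (EuclideanSpace.single b (1 : ℝ))) a = if a = b then (1 : ℝ) else 0 := fun a b => by
    simp
  have hent : ∀ a b : Fin 3, |(U (EuclideanSpace.single b (1 : ℝ))) a - ((1 : E3 →L[ℝ] E3) (EuclideanSpace.single b (1 : ℝ))) a| ≤
      (|(c (Sum.inl (a, b)) : ℝ) - (if a = b then (SC : ℝ) else 0)| + w (Sum.inl (a, b))) / SC := by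
    intro a b
    have h := hbox (a, b)
    rw [hδ, add_div]
    have t := abs_sub_le ((U (EuclideanSpace.single b (1 : ℝ))) a) ((c (Sum.inl (a, b)) : ℝ) / SC) (if a = b then (1 : ℝ) else 0)
    have e : |(c (Sum.inl (a, b)) : ℝ) / SC - (if a = b then (1 : ℝ) else 0)| = |(c (Sum.inl (a, b)) : ℝ) - (if a = b then (SC : ℝ) else 0)| / SC := by
      have ei : (if a = b then (1 : ℝ) else 0) = (if a = b then (SC : ℝ) else 0) / SC := by
        split_ifs <;> simp [hS.ne']
      rw [ei, ← sub_div, abs_div, abs_of_pos hS]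
    rw [e] at t
    exact t.trans (by linarith)
  have hF := norm_sub_le_sqrt_of_entries hent
  -- the integer fold
  set t : ℕ := (List.range 9).foldl (fun s n =>
    let a : Fin 3 := ⟨n / 3 % 3, by omega⟩
    let b : Fin 3 := ⟨n % 3, by omega⟩
    s + ((|c (Sum.inl (a, b)) - (if a = b then (SC : ℤ) else 0)| + w (Sum.inl (a, b))).natAbs) ^ 2) 0 with ht
  have et : t = 0 + ((|c (Sum.inl (0, 0)) - (if (0 : Fin 3) = 0 then (SC : ℤ) else 0)| + w (Sum.inl (0, 0))).natAbs) ^ 2 + ((|c (Sum.inl (0, 1)) - (if (0 : Fin 3) = 1 then (SC : ℤ) else 0)| + w (Sum.inl (0, 1))).natAbs) ^ 2 + ((|c (Sum.inl (0, 2)) - (if (0 : Fin 3) = 2 then (SC : ℤ) else 0)| + w (Sum.inl (0, 2))).natAbs) ^ 2 + ((|c (Sum.inl (1, 0)) - (if (1 : Fin 3) = 0 then (SC : ℤ) else 0)| + w (Sum.inl (1, 0))).natAbs) ^ 2 + ((|c (Sum.inl (1, 1)) - (if (1 : Fin 3) = 1 then (SC : ℤ) else 0)| + w (Sum.inl (1,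 1))).natAbs) ^ 2 + ((|c (Sum.inl (1, 2)) - (if (1 : Fin 3) = 2 then (SC : ℤ) else 0)| + w (Sum.inl (1, 2))).natAbs) ^ 2 + ((|c (Sum.inl (2, 0)) - (if (2 : Fin 3) = 0 then (SC : ℤ) else 0)| + w (Sum.inl (2, 0))).natAbs) ^ 2 + ((|c (Sum.inl (2, 1)) - (if (2 : Fin 3) = 1 then (SC : ℤ) else 0)| + w (Sum.inl (2, 1))).natAbs) ^ 2 + ((|c (Sum.inl (2, 2)) - (if (2 : Fin 3) = 2 then (SC : ℤ) else 0)| + w (Sum.inl (2, 2))).natAbs) ^ 2 := by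
    rw [ht]; rfl
  have hsum : (‖U - 1‖ * SC) ^ 2 ≤ (t : ℝ) := by
    have h1 : (‖U - 1‖ * SC) ^ 2 ≤ (∑ a : Fin 3, ∑ b : Fin 3, ((|(c (Sum.inl (a, b)) : ℝ) - (if a = b then (SC : ℝ) else 0)| + w (Sum.inl (a, b))) / SC) ^ 2) * SC ^ 2 := by
      rw [mul_pow]
      refine mul_le_mul_of_nonneg_right ?_ (by positivity)
      calc ‖U - 1‖ ^ 2 ≤ (Real.sqrt (∑ a : Fin 3, ∑ b : Fin 3, ((|(c (Sum.inl (a, b)) : ℝ) - (if a = b then (SC : ℝ) else 0)| + w (Sum.inl (a, b))) / SC) ^ 2)) ^ 2 :=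
            pow_le_pow_left₀ (norm_nonneg _) hF 2
        _ = _ := Real.sq_sqrt (by positivity)
    refine h1.trans (le_of_eq ?_)
    have e2 : (∑ a : Fin 3, ∑ b : Fin 3, ((|(c (Sum.inl (a, b)) : ℝ) - (if a = b then (SC : ℝ) else 0)| + w (Sum.inl (a, b))) / SC) ^ 2) * SC ^ 2 =
        ∑ a : Fin 3, ∑ b : Fin 3, (|(c (Sum.inl (a, b)) : ℝ) - (if a = b then (SC : ℝ) else 0)| + w (Sum.inl (a, b))) ^ 2 := by
      rw [Finset.sum_mul]
      refine Finset.sum_congr rfl fun a _ => ?_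
      rw [Finset.sum_mul]
      refine Finset.sum_congr rfl fun b _ => ?_
      rw [div_pow, div_mul_cancel₀ _ (by positivity)]
    rw [e2, et]
    push_cast [cast_natAbs_sq]
    have n02 : ¬ ((0 : Fin 3) = 2) := by decide
    have n12 : ¬ ((1 : Fin 3) = 2) := by decide
    have n20 : ¬ ((2 : Fin 3) = 0) := by decide
    have n21 : ¬ ((2 : Fin 3) = 1) := by decide
    norm_num [Fin.sum_univ_three, n02, n12, n20, n21]
    ring
  have hsq : (t : ℝ) ≤ ((natSqrtUp t : ℕ) : ℝ) ^ 2 := by exact_mod_cast le_natSqrtUp_sq t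
  have hx : froDevI c w = (natSqrtUp t : ℤ) := by unfold froDevI; rw [ht]
  rw [hx]; push_cast
  exact abs_le_of_sq_le_sq' (hsum.trans hsq) (by positivity) |>.2

/-! ## The prefilter drops only far labels -/

/-- The real chain behind the prefilter: `σ·SC ≥ sU > 0`, `‖U q‖ ≥ σ‖q‖`, `‖q‖·SC ≥ R − D` with `3R² ≤ 3‖p‖²SC²`-type test failed,
`R ≥ 9SC²/(2sU) + D` ⟹ `‖U q‖ ≥ 9/2`. [arithmetic] -/
theorem far_of_test {ρ σ nq np D R sU : ℝ} (hS : (0 : ℝ) < SC) (hsU : 0 < sU) (hσ : sU ≤ σ * SC) (hρ : σ * nq ≤ ρ) (hnq : np - D ≤ nq)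
    (hnp0 : 0 ≤ np) (htest : R ^ 2 ≤ (np * SC) ^ 2) (hR : 9 * SC * SC / (2 * sU) + D * SC ≤ R) : 9 / 2 ≤ ρ := by
  have hR0 : 0 ≤ 9 * SC * SC / (2 * sU) := by positivity
  have h1 : R ≤ np * SC := abs_le_of_sq_le_sq' htest (by positivity) |>.2
  have h2 : 9 * SC / (2 * sU) ≤ nq := by
    have : 9 * SC * SC / (2 * sU) = 9 * SC / (2 * sU) * SC := by ring
    rw [this] at hR
    have h3 : (9 * SC / (2 * sU) + D) * SC ≤ np * SC := by linarith
    have h4 := le_of_mul_le_mul_right h3 hS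
    linarith
  have hσ0 : 0 ≤ σ := by nlinarith
  have hq0 : 0 ≤ 9 * SC / (2 * sU) := by positivity
  calc (9 : ℝ) / 2 = sU / SC * (9 * SC / (2 * sU)) := by field_simp
    _ ≤ σ * (9 * SC / (2 * sU)) := mul_le_mul_of_nonneg_right ((div_le_iff₀ hS).2 hσ) hq0
    _ ≤ σ * nq := mul_le_mul_of_nonneg_left h2 hσ0
    _ ≤ ρ := hρ

/-- ★★ **`preLabels` (B family) DROPS ONLY FAR LABELS**: `b ∈ boxLabels7 ∖ preLabels true c w` ⟹ `9/2 ≤ ‖latPt U hexFrame b + U(hcpShift + ξ)‖` for every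
`(U, ξ)` of the box — so `W₄₅ ≡ 0` there and the fused lists lose nothing. [folklore chaining] -/
theorem farB_of_not_preLabels {c w : (Fin 3 × Fin 3) ⊕ Fin 3 → ℤ} {b : Fin 3 → ℤ} (hb7 : b ∈ boxLabels7) (hnot : b ∉ preLabels true c w)
    (U : E3 →L[ℝ] E3) (ξ : E3)
    (hbox : ∀ ab : Fin 3 × Fin 3, |(U (EuclideanSpace.single ab.2 (1 : ℝ))) ab.1 - (c (Sum.inl ab) : ℝ) / SC| ≤ (w (Sum.inl ab) : ℝ) / SC)
    (hξ : ∀ i : Fin 3, |ξ i - (c (Sum.inr i) : ℝ) / SC| ≤ (w (Sum.inr i) : ℝ) / SC) :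
    9 / 2 ≤ ‖latPt U hexFrame b + U (hcpShift + ξ)‖ := by
  have hS := SC_pos
  by_cases hs : (SC : ℤ) - froDevI c w ≤ (SC : ℤ) / 2
  · simp only [preLabels, hs, if_true] at hnot
    exact absurd hb7 hnot
  · simp only [preLabels, hs, if_false, if_true, List.mem_filter, decide_eq_true_eq, not_and, not_lt] at hnot
    have htest := hnot hb7
    -- integer side
    have h2pos : (0 : ℤ) < 2 * ((SC : ℤ) - froDevI c w) := by
      have : (0 : ℤ) ≤ (SC : ℤ) / 2 := Int.ediv_nonneg (by positivity) (by norm_num)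
      omega
    have hsU : (0 : ℝ) < ((SC : ℤ) - froDevI c w : ℤ) := by exact_mod_cast (show (0 : ℤ) < (SC : ℤ) - froDevI c w by omega)
    have hc := div_le_cdiv (a := 9 * (SC : ℤ) * (SC : ℤ)) (b := 2 * ((SC : ℤ) - froDevI c w)) h2pos
    -- real side
    have eq1 : U (latPt (1 : E3 →L[ℝ] E3) hexFrame b + (hcpShift + ξ)) = latPt U hexFrame b + U (hcpShift + ξ) := by
      rw [map_add, ← latPt_eq_apply_one]
    rw [← eq1]
    have hσ := norm_sub_one_le_froDevI U hbox
    have hx := norm_xi_le_xiMaxI ξ hξ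
    have hp := normSq_latPt_one b
    have htestR : ((((cdiv (9 * (SC : ℤ) * (SC : ℤ)) (2 * ((SC : ℤ) - froDevI c w)) : ℤ) : ℝ) + ((SC : ℝ) + (xiMaxI c w : ℝ))) ^ 2) ≤
        (‖latPt (1 : E3 →L[ℝ] E3) hexFrame b‖ * SC) ^ 2 := by
      have h3 : ((3 * (cdiv (9 * (SC : ℤ) * (SC : ℤ)) (2 * ((SC : ℤ) - froDevI c w)) + ((SC : ℤ) + xiMaxI c w)) *
          (cdiv (9 * (SC : ℤ) * (SC : ℤ)) (2 * ((SC : ℤ) - froDevI c w)) + ((SC : ℤ) + xiMaxI c w)) : ℤ) : ℝ) ≤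
          ((hexNormSq3 b * ((SC : ℤ) * (SC : ℤ)) : ℤ) : ℝ) := by exact_mod_cast htest
      push_cast at h3
      nlinarith [h3, hp]
    push_cast at hc
    have hσ' : (((SC : ℤ) - froDevI c w : ℤ) : ℝ) ≤ (1 - ‖U - 1‖) * SC := by push_cast; linarith
    have hnq : ‖latPt (1 : E3 →L[ℝ] E3) hexFrame b‖ - (1 + (xiMaxI c w : ℝ) / SC) ≤ ‖latPt (1 : E3 →L[ℝ] E3) hexFrame b + (hcpShift + ξ)‖ := by
      have := norm_arg_ge b ξ
      have hx' : ‖ξ‖ ≤ (xiMaxI c w : ℝ) / SC := by rw [le_div_iff₀ hS]; exact hx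
      linarith
    have hR : 9 * SC * SC / (2 * (((SC : ℤ) - froDevI c w : ℤ) : ℝ)) + (1 + (xiMaxI c w : ℝ) / SC) * SC ≤
        ((cdiv (9 * (SC : ℤ) * (SC : ℤ)) (2 * ((SC : ℤ) - froDevI c w)) : ℤ) : ℝ) + ((SC : ℝ) + (xiMaxI c w : ℝ)) := by
      have e : (1 + (xiMaxI c w : ℝ) / SC) * SC = SC + (xiMaxI c w : ℝ) := by field_simp
      rw [e]
      push_cast at hc ⊢
      linarith
    exact far_of_test hS hsU hσ' (norm_apply_ge U _) hnq (norm_nonneg _) htestR hR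

/-- ★★ **`preLabels` (A family) DROPS ONLY FAR LABELS**: `b ∈ boxLabels7 ∖ preLabels false c w` ⟹ `9/2 ≤ ‖latPt U hexFrame b‖` on the entry box.
[folklore chaining] -/
theorem farA_of_not_preLabels {c w : (Fin 3 × Fin 3) ⊕ Fin 3 → ℤ} {b : Fin 3 → ℤ} (hb7 : b ∈ boxLabels7) (hnot : b ∉ preLabels false c w)
    (U : E3 →L[ℝ] E3)
    (hbox : ∀ ab : Fin 3 × Fin 3, |(U (EuclideanSpace.single ab.2 (1 : ℝ))) ab.1 - (c (Sum.inl ab) : ℝ) / SC| ≤ (w (Sum.inl ab) : ℝ) / SC) :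
    9 / 2 ≤ ‖latPt U hexFrame b‖ := by
  have hS := SC_pos
  by_cases hs : (SC : ℤ) - froDevI c w ≤ (SC : ℤ) / 2
  · simp only [preLabels, hs, if_true] at hnot
    exact absurd hb7 hnot
  · simp only [preLabels, hs, if_false, Bool.false_eq_true, List.mem_filter, decide_eq_true_eq, not_and, not_lt, add_zero] at hnot
    have htest := hnot hb7
    have h2pos : (0 : ℤ) < 2 * ((SC : ℤ) - froDevI c w) := by
      have : (0 : ℤ) ≤ (SC : ℤ) / 2 := Int.ediv_nonneg (by positivity) (by norm_num)
      omega
    have hsU : (0 : ℝ) < ((SC : ℤ) - froDevI c w : ℤ) := by exact_mod_cast (show (0 : ℤ) < (SC : ℤ) - froDevI c w by omega)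
    have hc := div_le_cdiv (a := 9 * (SC : ℤ) * (SC : ℤ)) (b := 2 * ((SC : ℤ) - froDevI c w)) h2pos
    rw [latPt_eq_apply_one U b]
    have hσ := norm_sub_one_le_froDevI U hbox
    have hp := normSq_latPt_one b
    have htestR : ((((cdiv (9 * (SC : ℤ) * (SC : ℤ)) (2 * ((SC : ℤ) - froDevI c w)) : ℤ) : ℝ)) ^ 2) ≤
        (‖latPt (1 : E3 →L[ℝ] E3) hexFrame b‖ * SC) ^ 2 := by
      have h3 : ((3 * (cdiv (9 * (SC : ℤ) * (SC : ℤ)) (2 * ((SC : ℤ) - froDevI c w))) *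
          (cdiv (9 * (SC : ℤ) * (SC : ℤ)) (2 * ((SC : ℤ) - froDevI c w))) : ℤ) : ℝ) ≤
          ((hexNormSq3 b * ((SC : ℤ) * (SC : ℤ)) : ℤ) : ℝ) := by exact_mod_cast htest
      push_cast at h3
      nlinarith [h3, hp]
    push_cast at hc
    have hσ' : (((SC : ℤ) - froDevI c w : ℤ) : ℝ) ≤ (1 - ‖U - 1‖) * SC := by push_cast; linarith
    have hnq : ‖latPt (1 : E3 →L[ℝ] E3) hexFrame b‖ - 0 ≤ ‖latPt (1 : E3 →L[ℝ] E3) hexFrame b‖ := by linarith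
    have hR : 9 * SC * SC / (2 * (((SC : ℤ) - froDevI c w : ℤ) : ℝ)) + 0 * SC ≤
        ((cdiv (9 * (SC : ℤ) * (SC : ℤ)) (2 * ((SC : ℤ) - froDevI c w)) : ℤ) : ℝ) := by
      push_cast at hc ⊢
      linarith
    exact far_of_test hS hsU hσ' (norm_apply_ge U _) hnq (norm_nonneg _) htestR hR

end Summit.AtomisticToContinuum.Crystallization.Theorems.FrustratedLawDichotomyStrainedPatchHomValueT2Kit
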